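import Literature.MathematicalPhysics.QuantumFieldTheory.Balaban1983to89.B5Prop12GHolds
import Literature.MathematicalPhysics.QuantumFieldTheory.Balaban1983to89.B5WalkRealisationTorus
import Literature.MathematicalPhysics.QuantumFieldTheory.Balaban1983to89.B5Bounds167Lattice
import Literature.MathematicalPhysics.QuantumFieldTheory.Balaban1983to89.DagBinding

/-!
# NODE 00 (YM-PLAN Track A) — the B5 group of the carrier bundle `X : DagBinding.PrintedCarriersR` AT THE CONCRETE OBJECTS of
# [Balaban1984PropagatorsI] (the propagator `G = Δ_a⁻¹` on B5's top-level tori and the unit-torus quadratic forms (1.64)–(1.67)),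
# assembled from the tree, and what it gives the DAG node N02 (`Dag.B5_main`)

NODE 00 STAGE-1 MODULE (seat `pub-ymgap-node00-def`, YM-PLAN §2a NODE 00; root module of record `Node00Carriers`, whose CONVENTIONS OF RECORD
block applies here), NOT by itself a discharge booking (node rows are booked by the plan seat and the leads).  HONEST FRAMING: definitions + kernel bookkeeping; the analytic content is the lit-balaban cell's — Prop. 1.1 for the
G-family of record `B5WalkRealisationTorus.prop11Printed_famG` (r02), Prop. 1.2 for it `B5Prop12GHolds.prop12_famG_printed` (p37 gen 7, by
p38's (1.132)-assembly), and (1.67) for the real unit-torus forms `B5Bounds167Lattice.bounds167_formOfLatticeR` (pv15 lineage) — cited by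
name.  Nothing of the series' end statement; no continuum ∕ mass-gap claim.

WHAT THIS FILE SHOWS (scoping report NODE00-SCOPING.md §2.4):
* `Node00.withB5 X fam forms` — generic plumbing: `X` with its B5 group (`I5`, `fam5`, `forms5`) replaced;
* `Node00.formsOfRecord d L` — the (1.64)–(1.67) form data indexed by B5's top-level tori `TopIdx d L`: at the torus `P` the REAL unit-torus
  forms `formOfLatticeR (L^K) (2L^m, …, 2L^m)` (`n = L^K` fine points per unit interval — `B5SiteBridgeP12.nP`; unit-lattice periods
  `P.sitesPerDir P.K = 2L^m` in every direction — Bałaban's cubic torus);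
* `Node00.withB5OfRecord X d L a` — the B5 group := (`TopIdx d L`, `B5Prop12GLattice.famG d L a`, `formsOfRecord d L`);
* `b5_withB5OfRecord` — at these carriers the leaf `b5` (`B5.MainBlock` = Prop. 1.1 ∧ Prop. 1.2 ∧ (1.67)) of the binding of record
  `Upstream.ofPrintedAllXP` HOLDS outright (`d ≥ 1`, `L` odd `> 1`, `a > 0`), and so does the N-binding's (`b5` is the same field there);
* `b5_main_withB5OfRecord` — hence `Dag.B5_main (DagBinding.leavesP w P)` (= the venue's `YMDAG.N02 w P`, «b4 → b5») for EVERY binding world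
  `w` whose upstream block is `ofPrintedAllXP (withB5OfRecord X d L a) Y Z V W`, every run `P` (the `b4` antecedent is not used).
LOCATED READINGS inherited from the lineage (listed for the cross-read ∕ rulings Q-N00-2∕3∕6, not adjudicated here): TOP-LEVEL tori only (`k = K`,
`η = L^{−K}`; every (m, K ≥ 1) — the level-k lattice of a torus (m, K) is the top level of the torus (m + K − k, k), so no printed instance is
lost, to be confirmed in the cross-read); `U = 1` (as printed: [B5] has no background field); the printed propagator `G = Δ_a⁻¹` itself
(`latticeSettingP12R`, «EVERY slot concrete» per r02 — p38's `B5Prop12GLattice` header); Combes–Thomas on the torus instead of the printed random walk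
for (1.114) (a PROOF route, not a carrier reading); mass `m² = 0` as in [B5]; the forms (1.65) = (1.66) identity is not certified in
`B5Bounds167Lattice` (its header, «What is NOT claimed» (1)) — `formΔk` is given by the third expression of (1.66).
-/

noncomputable section

namespace Literature.MathematicalPhysics.QuantumFieldTheory.Balaban1983to89.Node00

open DagBinding
open B5ResidualGpTorusHolds (TopIdx)
open B5SiteBridgeP12 (nP one_le_nP)
open B5Prop12GLattice (famG)
open B5Bounds167Lattice (formOfLatticeR bounds167_formOfLatticeR)

/-- Generic plumbing: the carrier bundle `X` with its B5 group ([Balaban1984PropagatorsI]: index type `I5`, the settings `fam5` of Props. 1.1–1.2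
and the form data `forms5` of (1.64)–(1.67)) replaced; every other group unchanged. [folklore] -/
def withB5 (X : PrintedCarriersR) {I : Type} (fam : I → B5.Setting) (forms : I → B5.FormData) : PrintedCarriersR :=
  { X with I5 := I, fam5 := fam, forms5 := forms }

/-- **The (1.64)–(1.67) form data of record**, indexed by B5's top-level tori: at the torus `P` (`P.d = d`, `P.L = L`, `K ≥ 1`) the REAL
unit-torus forms `⟨B, Δ_kB⟩`, `⟨∂₁B, ∂₁B⟩` of the pv15 lineage (`formOfLatticeR`) with `n = L^K` fine points per unit interval and the unit
lattice `T₁^{(K)}` of `2L^m` sites per direction (`Params.sitesPerDir P K`). [cite: Balaban1984PropagatorsI, (1.64)–(1.67) p.29] -/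
def formsOfRecord (d L : ℕ) : TopIdx d L → B5.FormData :=
  fun i => formOfLatticeR (d := d) (nP i.P) (fun _ : Fin d => i.P.sitesPerDir i.P.K)

/-- **(1.67) HOLDS for the form data of record** (`bounds167_formOfLatticeR` at the index `TopIdx d L`; constants `γ₀ = (4/π²)^(d+2)`,
`γ₁ = (π²/4)^(2d+4)`, the lineage's). [cite: Balaban1984PropagatorsI, (1.67) p.29 (kernel version of the pv15 lineage)] -/
theorem bounds167_formsOfRecord (d L : ℕ) : B5.Bounds167 (formsOfRecord d L) :=
  bounds167_formOfLatticeR (I := TopIdx d L) (fun i => nP i.P) (fun i => one_le_nP i.P)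
    (fun i (_ : Fin d) => i.P.sitesPerDir i.P.K)

/-- **The carrier bundle `X` with its B5 group set to the CONCRETE objects of the lit-balaban lineages**: index = B5's top-level tori
`TopIdx d L`, settings = the G-family of record `famG d L a` (`G = Δ_a⁻¹`, r02's `latticeSettingP12R`), forms = `formsOfRecord d L`.
[cite: Balaban1984PropagatorsI, Props. 1.1–1.2 pp.33–36, (1.64)–(1.67) p.29] -/
def withB5OfRecord (X : PrintedCarriersR) (d L : ℕ) (a : ℝ) : PrintedCarriersR :=
  withB5 X (famG d L a) (formsOfRecord d L)

/-- **Leaf `b5` HOLDS at the B5 objects of the lineage** (`d ≥ 1`, `L` odd `> 1`, `a > 0`): `B5.MainBlock` = Prop. 1.1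
(`prop11Printed_famG`) ∧ Prop. 1.2 (`prop12_famG_printed`) ∧ (1.67) (`bounds167_formsOfRecord`), by name. [cite: Balaban1984PropagatorsI, Prop. 1.1 p.33, Prop. 1.2 pp.35–36, (1.67) p.29 (kernel versions of the lit-balaban lineages for their concrete torus families)] -/
theorem b5_withB5OfRecord (X : PrintedCarriersR) (Y : PrintedCarriers9X) (Z : PrintedCarriers11) (V : PrintedCarriers14R)
    (W : PrintedCarriers15) {d L : ℕ} (hd : 1 ≤ d) (hL : Odd L ∧ 1 < L) {a : ℝ} (ha : 0 < a) :
    (Upstream.ofPrintedAllXP (withB5OfRecord X d L a) Y Z V W).b5 :=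
  ⟨B5WalkRealisationTorus.prop11Printed_famG d L ha, B5Prop12GHolds.prop12_famG_printed hd hL ha,
    bounds167_formsOfRecord d L⟩

/-- **Consequently the DAG node N02 (`Dag.B5_main` = «b4 → b5») holds at EVERY binding world whose upstream block is the binding of record over
carriers with this B5 group**, every run `P` — the antecedent `b4` is not used (venue form: `YMDAG.N02 w P`).  Bookkeeping over the lineages'
theorems; whether these carriers are «the objects of record» is the ruling Q-N00-2, not asserted here.
[cite: Balaban1984PropagatorsI, Props. 1.1–1.2 pp.33–36, (1.67) p.29 (kernel versions of the lit-balaban lineages)] -/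
theorem b5_main_withB5OfRecord (X : PrintedCarriersR) (Y : PrintedCarriers9X) (Z : PrintedCarriers11) (V : PrintedCarriers14R)
    (W : PrintedCarriers15) {d L : ℕ} (hd : 1 ≤ d) (hL : Odd L ∧ 1 < L) {a : ℝ} (ha : 0 < a) (w : WorldP)
    (hw : w.up = fun _ => Upstream.ofPrintedAllXP (withB5OfRecord X d L a) Y Z V W) (P : B12.RunParams) :
    Dag.B5_main (leavesP w P) := by
  intro _
  show (w.up P).b5
  rw [hw]
  exact b5_withB5OfRecord X Y Z V W hd hL ha

end Literature.MathematicalPhysics.QuantumFieldTheory.Balaban1983to89.Node00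

end
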